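import Summits.Ventures.PercRepro.ProfilePointedSeqConvIdentity

/-!
# PercRepro — THE ARITHMETIC HALF OF «(Ĉ) IS CLOSED UNDER DIRECT SUMS», II: THE THEOREM (p10, gen 23;
`proofs/P10-COLOOPEXT-g22.md` §7.4, §7.5, §7.8)

`ProfilePointedSeqConv.lean` states the sequence-level theorem as the `Prop` `SeqPointedConv`: for zero-extended
sequences `P` on `[0, N₁]`, `c` on `[0, N₁ − 1]`, `a` on `[0, N₂]` — symmetric, non-negative, Theorem-A — with
`c 0 = P 0` and the (Ĉ)-defects of `(P, c)` non-negative on the window, the convolutions `a ∗ P`, `a ∗ c` satisfy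
(Ĉ) on `N₁ + N₂` elements at every level `2k + 2 ≤ N₁ + N₂`.  THIS FILE PROVES IT (`seqPointedConv_holds`), on the
bookkeeping of `ProfilePointedSeqConvIdentity.lean`.

The proof is the paper's, with one change of bookkeeping: instead of folding each antisymmetric sum onto its lower
half, it is SYMMETRISED (`two_mul_sum_eq_sum_sub`), so that every summand is a product of two numbers of the same
sign (`defect_term_nonneg`, `slack_term_nonneg`, `weight_term_nonneg`, from the weak monotone-pair lemma
`pair_le_of_chain_int`), except the boundary pair `{k + 1, k − N₁}` of the defect sum, worth
`−2·P 0·(a (k+1) − a (k − N₁))`, which one mirrored pair of the slack / weight sums pays in each regime of §7.8: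
(a) `2k + 2 ≤ N₂` — the slack and weight terms at `j = k`; (b) `2k + 1 = N₂` — the weight term at `j = k`;
(c) `N₂ ≤ 2k`, `k + 1 ≤ N₂` — the weight term at `j = N₂ − 1 − k`; (d) `N₂ ≤ k` — `a (k + 1) = 0`.
Nothing here asserts (Ĉ); the bridge to matroids (`ProfilePointedDirectSum.lean`'s convolutions) is a separate module.
-/

namespace PercRepro.Cogirth

open Finset

/-! ### The symmetrised summands are non-negative (the monotone-pair lemma, termwise) -/

/-- **Defect terms**: for `k − N₁ + 1 ≤ j ≤ k` (every index of the symmetric range but the boundary pair),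
`D (k − j) · (a j − a (2k − N₁ + 1 − j)) ≥ 0`: below the middle both factors are `≥ 0` ((Ĉ) for `(P, c)` and the
monotone pair for `a`), at the middle `D` vanishes, above the middle both factors are `≤ 0` by the antisymmetry. -/
theorem defect_term_nonneg (N₁ N₂ : ℕ) (P c a : ℤ → ℚ) (hPs : ∀ i, P ((N₁ : ℤ) - i) = P i)
    (hcs : ∀ i, c ((N₁ : ℤ) - 1 - i) = c i)
    (hD : ∀ i : ℤ, 0 ≤ i → 2 * i + 2 ≤ N₁ → 0 ≤ seqDefect N₁ P c i)
    (ha0 : ∀ j, j < 0 → a j = 0) (has : ∀ j, a ((N₂ : ℤ) - j) = a j) (hann : ∀ j, 0 ≤ a j)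
    (haA' : ∀ j : ℤ, 0 ≤ j → 2 * j + 2 ≤ (N₂ : ℤ) →
      (((N₂ : ℤ) : ℚ) - j) * a j ≤ (j + 1) * a (j + 1))
    (k : ℤ) (hkN : 2 * k + 2 ≤ N₁ + N₂) (j : ℤ) (hj0 : k - N₁ + 1 ≤ j) (hj1 : j ≤ k) :
    0 ≤ seqDefect N₁ P c (k - j) * (a j - a (2 * k - N₁ + 1 - j)) := by
  rcases lt_trichotomy (2 * (k - j) + 1) N₁ with h | h | h
  · apply mul_nonneg (hD (k - j) (by omega) (by omega))
    have := pair_le_of_chain_int N₂ a ha0 has hann haA' (x := j) (y := 2 * k - N₁ + 1 - j)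
      (by omega) (by omega)
    linarith
  · have hr := seqDefect_reflect N₁ P c hPs hcs (k - j)
    rw [show (N₁ : ℤ) - 1 - (k - j) = k - j by omega] at hr
    have : seqDefect N₁ P c (k - j) = 0 := by linarith
    rw [this]
    simp
  · have hr := seqDefect_reflect N₁ P c hPs hcs (k - (2 * k - N₁ + 1 - j))
    rw [show (N₁ : ℤ) - 1 - (k - (2 * k - N₁ + 1 - j)) = k - j by ring] at hr
    have hD' : 0 ≤ seqDefect N₁ P c (k - (2 * k - N₁ + 1 - j)) := hD _ (by omega) (by omega)
    have hpair := pair_le_of_chain_int N₂ a ha0 has hann haA' (x := 2 * k - N₁ + 1 - j) (y := j)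
      (by omega) (by omega)
    rw [hr, neg_mul, ← mul_neg, neg_sub]
    exact mul_nonneg hD' (sub_nonneg.2 hpair)

/-- **Slack terms**: for `0 ≤ j ≤ N₂ − 1`, `α j · (P (k − j) − P (k − (N₂ − 1 − j))) ≥ 0`. -/
theorem slack_term_nonneg (N₁ N₂ : ℕ) (P a : ℤ → ℚ) (hP0 : ∀ i, i < 0 → P i = 0)
    (hPs : ∀ i, P ((N₁ : ℤ) - i) = P i) (hPnn : ∀ i, 0 ≤ P i)
    (hPA' : ∀ i : ℤ, 0 ≤ i → 2 * i + 2 ≤ (N₁ : ℤ) →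
      (((N₁ : ℤ) : ℚ) - i) * P i ≤ (i + 1) * P (i + 1))
    (has : ∀ j, a ((N₂ : ℤ) - j) = a j)
    (haA : ∀ j : ℤ, 0 ≤ j → 2 * j + 2 ≤ N₂ → ((N₂ : ℚ) - j) * a j ≤ (j + 1) * a (j + 1))
    (k : ℤ) (hkN : 2 * k + 2 ≤ N₁ + N₂) (j : ℤ) (hj0 : 0 ≤ j) (hj1 : j ≤ (N₂ : ℤ) - 1) :
    0 ≤ seqSlack N₂ a j * (P (k - j) - P (k - ((N₂ : ℤ) - 1 - j))) := by
  rcases lt_trichotomy (2 * j + 1) N₂ with h | h | h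
  · have hs : 0 ≤ seqSlack N₂ a j := by
      unfold seqSlack
      have := haA j hj0 (by omega)
      linarith
    apply mul_nonneg hs
    have := pair_le_of_chain_int N₁ P hP0 hPs hPnn hPA' (x := k - j) (y := k - ((N₂ : ℤ) - 1 - j))
      (by omega) (by omega)
    linarith
  · have hr := seqSlack_reflect N₂ a has j
    rw [show (N₂ : ℤ) - 1 - j = j by omega] at hr
    have : seqSlack N₂ a j = 0 := by linarith
    rw [this]
    simp
  · have hr := seqSlack_reflect N₂ a has ((N₂ : ℤ) - 1 - j)
    rw [show (N₂ : ℤ) - 1 - ((N₂ : ℤ) - 1 - j) = j by ring] at hr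
    have hs' : 0 ≤ seqSlack N₂ a ((N₂ : ℤ) - 1 - j) := by
      unfold seqSlack
      have := haA ((N₂ : ℤ) - 1 - j) (by omega) (by omega)
      push_cast at this ⊢
      linarith
    have hpair := pair_le_of_chain_int N₁ P hP0 hPs hPnn hPA' (x := k - ((N₂ : ℤ) - 1 - j))
      (y := k - j) (by omega) (by omega)
    rw [hr, neg_mul, ← mul_neg, neg_sub]
    exact mul_nonneg hs' (sub_nonneg.2 hpair)

/-- **Weight terms**: `W j · (c (k − j) − c (k − (N₂ − j))) ≥ 0` for every `j` (the range is not even needed). -/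
theorem weight_term_nonneg (N₁ N₂ : ℕ) (c a : ℤ → ℚ) (hc0 : ∀ i, i < 0 → c i = 0)
    (hcs : ∀ i, c ((N₁ : ℤ) - 1 - i) = c i) (hcnn : ∀ i, 0 ≤ c i)
    (hcA' : ∀ i : ℤ, 0 ≤ i → 2 * i + 2 ≤ (N₁ : ℤ) - 1 →
      ((((N₁ : ℤ) - 1 : ℤ) : ℚ) - i) * c i ≤ (i + 1) * c (i + 1))
    (has : ∀ j, a ((N₂ : ℤ) - j) = a j) (hann : ∀ j, 0 ≤ a j)
    (k : ℤ) (hkN : 2 * k + 2 ≤ N₁ + N₂) (j : ℤ) :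
    0 ≤ seqWeight N₂ a j * (c (k - j) - c (k - ((N₂ : ℤ) - j))) := by
  rcases lt_trichotomy (2 * j) N₂ with h | h | h
  · have hw : 0 ≤ seqWeight N₂ a j := by
      unfold seqWeight
      apply mul_nonneg _ (hann j)
      have : (2 * j : ℚ) < N₂ := by exact_mod_cast h
      linarith
    apply mul_nonneg hw
    have := pair_le_of_chain_int ((N₁ : ℤ) - 1) c hc0 hcs hcnn hcA' (x := k - j)
      (y := k - ((N₂ : ℤ) - j)) (by omega) (by omega)
    linarith
  · have hw : seqWeight N₂ a j = 0 := by
      unfold seqWeight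
      have : (2 * j : ℚ) = N₂ := by exact_mod_cast h
      rw [show ((N₂ : ℚ) - 2 * j) = 0 by linarith]
      ring
    rw [hw]
    simp
  · have hr := seqWeight_reflect N₂ a has ((N₂ : ℤ) - j)
    rw [show (N₂ : ℤ) - ((N₂ : ℤ) - j) = j by ring] at hr
    have hw' : 0 ≤ seqWeight N₂ a ((N₂ : ℤ) - j) := by
      unfold seqWeight
      apply mul_nonneg _ (hann _)
      have : (N₂ : ℚ) < 2 * j := by exact_mod_cast h
      push_cast
      linarith
    have hpair := pair_le_of_chain_int ((N₁ : ℤ) - 1) c hc0 hcs hcnn hcA' (x := k - ((N₂ : ℤ) - j))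
      (y := k - j) (by omega) (by omega)
    rw [hr, neg_mul, ← mul_neg, neg_sub]
    exact mul_nonneg hw' (sub_nonneg.2 hpair)

/-! ### The theorem -/

/-- **THE ARITHMETIC HALF OF THE DIRECT-SUM THEOREM** (`SeqPointedConv`, stated in `ProfilePointedSeqConv.lean`):
the identity (7.2), symmetrised; every summand non-negative except the boundary pair of the defect sum, worth
`−2·P 0·(a (k+1) − a (k − N₁))`; one mirrored pair of the slack / weight sums pays it in each regime —
(a) `2k + 2 ≤ N₂`: the slack and weight terms at `j = k`; (b) `2k + 1 = N₂`: the weight term at `j = k`;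
(c) `N₂ ≤ 2k`, `k + 1 ≤ N₂`: the weight term at `j = N₂ − 1 − k`; (d) `N₂ ≤ k`: `a (k+1) = 0`. -/
theorem seqPointedConv_holds : SeqPointedConv := by
  intro N₁ N₂ P c a hP0 hP1 hPs hPnn hPA hc0 hc1 hcs hcnn hcA hcP hC ha0 ha1 has hann haA k hk hkN
  -- the Theorem-A hypotheses with their `ℤ`-cast bounds
  have hPA' : ∀ i : ℤ, 0 ≤ i → 2 * i + 2 ≤ (N₁ : ℤ) →
      (((N₁ : ℤ) : ℚ) - i) * P i ≤ (i + 1) * P (i + 1) := by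
    intro i h1 h2
    push_cast
    exact hPA i h1 h2
  have hcA' : ∀ i : ℤ, 0 ≤ i → 2 * i + 2 ≤ (N₁ : ℤ) - 1 →
      ((((N₁ : ℤ) - 1 : ℤ) : ℚ) - i) * c i ≤ (i + 1) * c (i + 1) := by
    intro i h1 h2
    push_cast
    exact hcA i h1 h2
  have haA' : ∀ j : ℤ, 0 ≤ j → 2 * j + 2 ≤ (N₂ : ℤ) →
      (((N₂ : ℤ) : ℚ) - j) * a j ≤ (j + 1) * a (j + 1) := by
    intro j h1 h2
    push_cast
    exact haA j h1 h2
  have hD : ∀ i : ℤ, 0 ≤ i → 2 * i + 2 ≤ N₁ → 0 ≤ seqDefect N₁ P c i := by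
    intro i h1 h2
    unfold seqDefect
    have := hC i h1 h2
    linarith
  rw [← sub_nonneg, seq_identity N₁ N₂ P c a ha0 ha1 k,
    sum_defect_range N₁ N₂ P c a hP0 hP1 hc0 hc1 ha0 ha1 k, sum_slack_range N₂ a P ha1 k]
  -- the antisymmetries on the three ranges
  have hgD : ∀ i, seqDefect N₁ P c (k - (2 * k - N₁ + 1 - i)) = - seqDefect N₁ P c (k - i) := by
    intro i
    rw [show k - (2 * k - N₁ + 1 - i) = (N₁ : ℤ) - 1 - (k - i) by ring]
    exact seqDefect_reflect N₁ P c hPs hcs (k - i)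
  -- symmetrise
  have eD := two_mul_sum_eq_sum_sub (k - N₁) (k + 1) (2 * k - N₁ + 1) (by ring)
    (fun j => seqDefect N₁ P c (k - j)) a hgD
  have eS := two_mul_sum_eq_sum_sub 0 ((N₂ : ℤ) - 1) ((N₂ : ℤ) - 1) (by ring) (seqSlack N₂ a)
    (fun j => P (k - j)) (seqSlack_reflect N₂ a has)
  have eW := two_mul_sum_eq_sum_sub 0 N₂ N₂ (by ring) (seqWeight N₂ a) (fun j => c (k - j))
    (seqWeight_reflect N₂ a has)
  beta_reduce at eD eS eW
  -- the non-negative terms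
  have hnnD : ∀ i, k - N₁ ≤ i → i ≤ k + 1 → i ≠ k + 1 → i ≠ 2 * k - N₁ + 1 - (k + 1) →
      0 ≤ seqDefect N₁ P c (k - i) * (a i - a (2 * k - N₁ + 1 - i)) := fun i h1 h2 h3 h4 =>
    defect_term_nonneg N₁ N₂ P c a hPs hcs hD ha0 has hann haA' k hkN i (by omega) (by omega)
  have hnnS : ∀ j, 0 ≤ j → j ≤ (N₂ : ℤ) - 1 →
      0 ≤ seqSlack N₂ a j * (P (k - j) - P (k - ((N₂ : ℤ) - 1 - j))) := fun j h1 h2 =>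
    slack_term_nonneg N₁ N₂ P a hP0 hPs hPnn hPA' has haA k hkN j h1 h2
  have hnnW : ∀ j, 0 ≤ j → j ≤ (N₂ : ℤ) →
      0 ≤ seqWeight N₂ a j * (c (k - j) - c (k - ((N₂ : ℤ) - j))) := fun j _ _ =>
    weight_term_nonneg N₁ N₂ c a hc0 hcs hcnn hcA' has hann k hkN j
  have hS0 : 0 ≤ ∑ j ∈ Icc (0 : ℤ) ((N₂ : ℤ) - 1),
      seqSlack N₂ a j * (P (k - j) - P (k - ((N₂ : ℤ) - 1 - j))) :=
    Finset.sum_nonneg (fun j hj => hnnS j (mem_Icc.1 hj).1 (mem_Icc.1 hj).2)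
  have hW0 : 0 ≤ ∑ j ∈ Icc (0 : ℤ) N₂, seqWeight N₂ a j * (c (k - j) - c (k - ((N₂ : ℤ) - j))) :=
    Finset.sum_nonneg (fun j hj => hnnW j (mem_Icc.1 hj).1 (mem_Icc.1 hj).2)
  -- the boundary pair of the defect sum
  have hbd := two_mul_term_le_sum (k - N₁) (k + 1) (2 * k - N₁ + 1) (by ring)
    (fun j => seqDefect N₁ P c (k - j)) a hgD (k + 1) hnnD (by omega) (le_refl _) (by omega)
  beta_reduce at hbd
  rw [show k - (k + 1) = -1 by ring, show 2 * k - (N₁ : ℤ) + 1 - (k + 1) = k - N₁ by ring,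
    seqDefect_neg_one N₁ P c hP0 hc0] at hbd
  have hPa : 0 ≤ P 0 * a (k - N₁) := mul_nonneg (hPnn 0) (hann _)
  -- the four regimes
  rcases le_or_gt (2 * k + 2) (N₂ : ℤ) with hka | hka
  · -- (a) `2k + 2 ≤ N₂`: the slack and weight terms at `j = k`
    have hSk := two_mul_term_le_sum 0 ((N₂ : ℤ) - 1) ((N₂ : ℤ) - 1) (by ring) (seqSlack N₂ a)
      (fun j => P (k - j)) (seqSlack_reflect N₂ a has) k (fun i h1 h2 _ _ => hnnS i h1 h2)
      hk (by omega) (by omega)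
    have hWk := two_mul_term_le_sum 0 N₂ N₂ (by ring) (seqWeight N₂ a) (fun j => c (k - j))
      (seqWeight_reflect N₂ a has) k (fun i h1 h2 _ _ => hnnW i h1 h2) hk (by omega) (by omega)
    beta_reduce at hSk hWk
    rw [sub_self, hP0 (k - ((N₂ : ℤ) - 1 - k)) (by omega)] at hSk
    rw [sub_self, hc0 (k - ((N₂ : ℤ) - k)) (by omega), hcP] at hWk
    have hvS : seqSlack N₂ a k = ((k : ℚ) + 1) * a (k + 1) - ((N₂ : ℚ) - (k : ℚ)) * a k := rfl
    have hvW : seqWeight N₂ a k = ((N₂ : ℚ) - 2 * (k : ℚ)) * a k := rfl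
    rw [hvS] at hSk
    rw [hvW] at hWk
    -- `a k ≤ a (k + 1)` below the middle
    have hak : a k ≤ a (k + 1) := by
      have h1 := haA k hk hka
      have h2 : ((k : ℚ) + 1) * a k ≤ ((N₂ : ℚ) - k) * a k := by
        apply mul_le_mul_of_nonneg_right _ (hann k)
        have : (2 * k + 1 : ℚ) ≤ N₂ := by exact_mod_cast (by omega : 2 * k + 1 ≤ (N₂ : ℤ))
        linarith
      have hpos : (0 : ℚ) < (k : ℚ) + 1 := by
        have : (0 : ℚ) ≤ k := by exact_mod_cast hk
        linarith
      exact le_of_mul_le_mul_left (h2.trans h1) hpos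
    have hk' : (0 : ℚ) ≤ k := by exact_mod_cast hk
    have hprod : 0 ≤ (k : ℚ) * (P 0 * (a (k + 1) - a k)) :=
      mul_nonneg hk' (mul_nonneg (hPnn 0) (sub_nonneg.2 hak))
    linarith
  rcases le_or_gt ((N₂ : ℤ)) (2 * k) with hkc | hkb
  · rcases le_or_gt (k + 1) (N₂ : ℤ) with hkc' | hkd
    · -- (c) `N₂ ≤ 2k`, `k + 1 ≤ N₂`: the weight term at `j = N₂ − 1 − k`
      have hWk := two_mul_term_le_sum 0 N₂ N₂ (by ring) (seqWeight N₂ a) (fun j => c (k - j))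
        (seqWeight_reflect N₂ a has) ((N₂ : ℤ) - (k + 1)) (fun i h1 h2 _ _ => hnnW i h1 h2)
        (by omega) (by omega) (by omega)
      beta_reduce at hWk
      rw [show k - ((N₂ : ℤ) - ((N₂ : ℤ) - (k + 1))) = -1 by ring, hc0 (-1) (by omega)] at hWk
      have hvW : seqWeight N₂ a ((N₂ : ℤ) - (k + 1)) =
          ((N₂ : ℚ) - 2 * (((N₂ : ℤ) - (k + 1) : ℤ) : ℚ)) * a ((N₂ : ℤ) - (k + 1)) := rfl
      rw [hvW, has (k + 1)] at hWk
      have hcx : c 0 ≤ c (k - ((N₂ : ℤ) - (k + 1))) :=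
        zero_le_of_chain_int ((N₁ : ℤ) - 1) c hc0 hcs hcnn hcA' (by omega) (by omega)
      rw [hcP] at hcx
      have hu : 0 ≤ a (k + 1) := hann _
      have hv : 0 ≤ c (k - ((N₂ : ℤ) - (k + 1))) := hcnn _
      have hw2 : (2 : ℚ) ≤ (N₂ : ℚ) - 2 * (((N₂ : ℤ) - (k + 1) : ℤ) : ℚ) := by
        push_cast
        have : (N₂ : ℚ) ≤ 2 * k := by exact_mod_cast hkc
        linarith
      have h1 : 2 * (a (k + 1) * c (k - ((N₂ : ℤ) - (k + 1)))) ≤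
          ((N₂ : ℚ) - 2 * (((N₂ : ℤ) - (k + 1) : ℤ) : ℚ)) * (a (k + 1) * c (k - ((N₂ : ℤ) - (k + 1)))) :=
        mul_le_mul_of_nonneg_right hw2 (mul_nonneg hu hv)
      have h2 : a (k + 1) * P 0 ≤ a (k + 1) * c (k - ((N₂ : ℤ) - (k + 1))) :=
        mul_le_mul_of_nonneg_left hcx hu
      linarith
    · -- (d) `N₂ < k + 1`: `a (k + 1) = 0`
      rw [ha1 (k + 1) hkd] at hbd
      linarith
  · -- (b) `2k + 1 = N₂`: the weight term at `j = k`
    have hN : (N₂ : ℤ) = 2 * k + 1 := by omega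
    have hWk := two_mul_term_le_sum 0 N₂ N₂ (by ring) (seqWeight N₂ a) (fun j => c (k - j))
      (seqWeight_reflect N₂ a has) k (fun i h1 h2 _ _ => hnnW i h1 h2) hk (by omega) (by omega)
    beta_reduce at hWk
    rw [sub_self, hc0 (k - ((N₂ : ℤ) - k)) (by omega), hcP] at hWk
    have hvW : seqWeight N₂ a k = ((N₂ : ℚ) - 2 * (k : ℚ)) * a k := rfl
    have hak : a k = a (k + 1) := by
      have := has (k + 1)
      rw [show (N₂ : ℤ) - (k + 1) = k by omega] at this
      exact this
    have hN' : (N₂ : ℚ) = 2 * k + 1 := by exact_mod_cast hN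
    rw [hvW, hak, hN'] at hWk
    linarith

end PercRepro.Cogirth
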